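import Summits.Ventures.GridStability.Models.WSCC9LossyLinearisation

/-!
# GridStability/Models/WSCC9LossyModes — the electromechanical modes of the lossy 9-bus linearisation EXIST at certified frequencies (two-sided enclosure by exact determinant sign changes)

Cell `gridfusion` (LADDER-GRIDFUSION, G3-ss; seat gridfusion-model-3 (g6)). Rider on ★ #37
«G3-ss-WSCC9-H12-LOSSY-UNIFORM» (`Models/WSCC9LossyLinearisation.lean` p506795), whose certificate gives the
ONE-SIDED fact «every non-synchronous pencil eigenvalue is real `> 38`» and whose frequencies `38.644 / 170.362 s⁻²`
(`0.99 / 2.08 Hz`) were informative floats only. This file makes them CERTIFIED TWO-SIDED numbers: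
* §0 ([folklore], any `n`) `exists_eig_of_det_nonpos` — a real matrix `A` with
  `det(a·1 − A) · det(b·1 − A) ≤ 0`, `a ≤ b`, HAS a real eigenvalue `ν ∈ [a, b]` with a real eigenvector
  (intermediate value theorem for `t ↦ det(t·1 − A)` + `Matrix.exists_mulVec_eq_zero_iff`);
  `secondOrderJac_eig_of_eig` — from `A x = ν x` (real, `ν > d²/4`) an EXPLICIT complex eigenpair of
  `J(A, d)`: `z = −d/2 + i·√(ν − d²/4)`, `w = [x; z x]` (the underdamped mode pair);
* §1 the instance `WSCC9.postB_rel` (exact `A = M⁻¹L(δ*)`, p506795): the exact rational determinants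
  `det(t·1 − A)` at `t = 3864/100, 3865/100, 17036/100, 17037/100` have signs `+, −, −, +` (`decide` after
  `Matrix.det_fin_three`), hence eigenvalues `ν₁ ∈ [38.64, 38.65]` and `ν₂ ∈ [170.36, 170.37]` EXIST
  (`postB_rel_exists_eig_slow` / `_fast`), and for every damping ratio `λ` with `λ² < 4·38.64` the Jacobian
  `J(δ*)` of `postB_rel.toModelRel λ a′` HAS mode pairs `z = −λ/2 ± i·ω_d` with
  `ω_d² = ν − λ²/4 ∈ [38.64 − λ²/4, 38.65 − λ²/4]` resp. `[170.36 − λ²/4, 170.37 − λ²/4]`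
  (`postB_rel_exists_mode_slow` / `_fast`); at the λ = 1/10 of record: damped frequencies
  `√(38.6375…38.6475)` and `√(170.3575…170.3675)` rad/s, i.e. `0.9893–0.9894 Hz` and `2.0773–2.0774 Hz`.
So the CERTIFIED column of #37 can carry «modes EXIST at 0.989 Hz and 2.077 Hz (4-digit enclosures) with
decay rate exactly λ/2» instead of informative floats. COST: four 3 × 3 exact determinants; 0 core-h. The same
§0 lemmas serve any `n = 3` object (a printed-comparator row, e.g. Sauer–Pai Ex. 8.4's pre-fault modes,
needs only its typed data). THREE COLUMNS. CERTIFIED: statements about the MATRIX `J(δ*)`; MODELLED: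
MV-2 + MV-P + MV-h12 + MV-λ as #37; VALIDATED: none. No sentence of this file says a grid is stable.
-/

noncomputable section

open Real Matrix Finset Set
open scoped ComplexOrder

namespace Summit.Ventures.GridStability.Models

/-! ## §0 Existence of eigenvalues from determinant sign changes; explicit underdamped mode pairs -/

section Generic

variable {ι : Type*} [Fintype ι] [DecidableEq ι]

/-- **A real eigenvalue in `[a, b]` from a sign change of `t ↦ det(t·1 − A)`** (intermediate value theorem;
the zero of the determinant gives a nonzero kernel vector of `ν·1 − A`). [folklore] -/
theorem exists_eig_of_det_nonpos (A : Matrix ι ι ℝ) {a b : ℝ} (hab : a ≤ b)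
    (h : (a • (1 : Matrix ι ι ℝ) - A).det * (b • (1 : Matrix ι ι ℝ) - A).det ≤ 0) :
    ∃ ν ∈ Icc a b, ∃ x : ι → ℝ, x ≠ 0 ∧ A *ᵥ x = ν • x := by
  set f : ℝ → ℝ := fun t => (t • (1 : Matrix ι ι ℝ) - A).det with hf
  have hcont : Continuous f :=
    ((continuous_id.smul continuous_const).sub continuous_const).matrix_det
  have hfa : f a = (a • (1 : Matrix ι ι ℝ) - A).det := rfl
  have hfb : f b = (b • (1 : Matrix ι ι ℝ) - A).det := rfl
  -- a zero of f in [a, b]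
  obtain ⟨ν, hν, hfν⟩ : ∃ ν ∈ Icc a b, f ν = 0 := by
    rw [← hfa, ← hfb] at h
    rcases le_total (f a) (f b) with hle | hle
    · have h0 : (0 : ℝ) ∈ Icc (f a) (f b) := by
        constructor <;> nlinarith
      obtain ⟨ν, hν, hfν⟩ := intermediate_value_Icc hab hcont.continuousOn h0
      exact ⟨ν, hν, hfν⟩
    · have h0 : (0 : ℝ) ∈ Icc (f b) (f a) := by
        constructor <;> nlinarith
      obtain ⟨ν, hν, hfν⟩ := intermediate_value_Icc' hab hcont.continuousOn h0
      exact ⟨ν, hν, hfν⟩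
  obtain ⟨x, hx, hAx⟩ := Matrix.exists_mulVec_eq_zero_iff.2 hfν
  refine ⟨ν, hν, x, hx, ?_⟩
  rw [Matrix.sub_mulVec, Matrix.smul_mulVec, Matrix.one_mulVec, sub_eq_zero] at hAx
  exact hAx.symm

/-- **The underdamped mode pair of `J(A, d)` over a real eigenpair of `A`.** If `A x = ν x` with `x ≠ 0` real
and `d²/4 < ν`, then `z = −d/2 + i·√(ν − d²/4)` and `w = [x; z·x]` satisfy `J(A, d) w = z w`, `w ≠ 0`,
`Re z = −d/2`, `(Im z)² = ν − d²/4`. [folklore] -/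
theorem secondOrderJac_eig_of_eig {A : Matrix ι ι ℝ} {d ν : ℝ} {x : ι → ℝ} (hx : x ≠ 0)
    (hAx : A *ᵥ x = ν • x) (hν : d ^ 2 / 4 < ν) :
    ∃ z : ℂ, ∃ w : ι ⊕ ι → ℂ, w ≠ 0 ∧
      (secondOrderJac A d).map ((↑) : ℝ → ℂ) *ᵥ w = z • w ∧ z.re = -(d / 2) ∧ z.im ^ 2 = ν - d ^ 2 / 4 := by
  set s : ℝ := Real.sqrt (ν - d ^ 2 / 4) with hsdef
  have hs2 : s ^ 2 = ν - d ^ 2 / 4 := by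
    rw [hsdef, Real.sq_sqrt (by linarith)]
  set z : ℂ := ⟨-(d / 2), s⟩ with hzdef
  set xc : ι → ℂ := fun i => (x i : ℂ) with hxcdef
  have hxc : xc ≠ 0 := by
    intro h0
    apply hx
    funext i
    have := congr_fun h0 i
    simpa [hxcdef] using this
  -- z² + d z + ν = 0
  have hzq : z ^ 2 + (d : ℂ) * z + (ν : ℂ) = 0 := by
    refine Complex.ext ?_ ?_
    · simp [hzdef, sq, Complex.mul_re]
      nlinarith [hs2]
    · simp [hzdef, sq, Complex.mul_im]
      ring
  -- A xc = ν xc over ℂ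
  have hAxc : A.map ((↑) : ℝ → ℂ) *ᵥ xc = (ν : ℂ) • xc := by
    funext i
    have := congr_fun hAx i
    simp only [Pi.smul_apply, smul_eq_mul] at this
    rw [map_ofReal_mulVec_apply]
    simp only [hxcdef, Pi.smul_apply, smul_eq_mul]
    have h2 : (∑ j, (A i j : ℂ) * (x j : ℂ)) = (((A *ᵥ x) i : ℝ) : ℂ) := by
      simp only [Matrix.mulVec, dotProduct]
      push_cast
      rfl
    rw [h2, this]
    push_cast
    ring
  refine ⟨z, Sum.elim xc (z • xc), ?_, ?_, by simp [hzdef], by simp [hzdef, hs2]⟩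
  · intro h0
    apply hxc
    funext i
    have := congr_fun h0 (Sum.inl i)
    simpa using this
  · rw [secondOrderJac_map_ofReal]
    refine (secondOrderJac_eig_iff _ _ z _).2 ⟨?_, ?_⟩
    · funext i; simp
    · have h1 : (Sum.elim xc (z • xc)) ∘ Sum.inl = xc := by funext i; simp
      rw [h1, hAxc, ← neg_smul]
      have : -(z ^ 2 + (d : ℂ) * z) = (ν : ℂ) := by linear_combination -hzq
      rw [this]

end Generic

/-! ## §1 The instance `WSCC9.postB_rel`: both electromechanical modes, two-sided -/

namespace WSCC9

open RecastData

/-- The exact characteristic determinant of `A = M⁻¹L(δ*)` of the lossy reduction at a rational point `t`,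
bridged to `ℚ`: `det(t·1 − A) = (det(t·1 − AblockQ) : ℚ)`. [folklore] -/
theorem postB_rel_charDet (lam : ℚ) (a : ℝ) (t : ℚ) :
    ((t : ℝ) • (1 : Matrix (Fin 3) (Fin 3) ℝ) - (postB_rel.toModelRel lam a).Ablock postB_rel.angleOf).det
      = (((t • (1 : Matrix (Fin 3) (Fin 3) ℚ) - postB_rel.AblockQ).det : ℚ) : ℝ) := by
  rw [postB_rel.Ablock_toModelRel_angleOf postB_rel_circle.1]
  have h : (t : ℝ) • (1 : Matrix (Fin 3) (Fin 3) ℝ) - postB_rel.AblockQ.map ((↑) : ℚ → ℝ)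
      = (t • (1 : Matrix (Fin 3) (Fin 3) ℚ) - postB_rel.AblockQ).map ((↑) : ℚ → ℝ) := by
    ext i j
    simp only [Matrix.sub_apply, Matrix.smul_apply, Matrix.one_apply, Matrix.map_apply, smul_eq_mul]
    split_ifs <;> push_cast <;> ring
  rw [h]
  exact (RingHom.map_det (Rat.castHom ℝ) _).symm

/-- The four exact determinant SIGNS: `det(t·1 − A)` is `> 0, < 0, < 0, > 0` at
`t = 3864/100, 3865/100, 17036/100, 17037/100` (floats ≈ `20.5, −30.4, −54.6, 169.8`). [folklore] -/
theorem postB_rel_charDet_signs :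
    0 < ((3864 / 100 : ℚ) • (1 : Matrix (Fin 3) (Fin 3) ℚ) - postB_rel.AblockQ).det ∧
    ((3865 / 100 : ℚ) • (1 : Matrix (Fin 3) (Fin 3) ℚ) - postB_rel.AblockQ).det < 0 ∧
    ((17036 / 100 : ℚ) • (1 : Matrix (Fin 3) (Fin 3) ℚ) - postB_rel.AblockQ).det < 0 ∧
    0 < ((17037 / 100 : ℚ) • (1 : Matrix (Fin 3) (Fin 3) ℚ) - postB_rel.AblockQ).det := by
  rw [Matrix.det_fin_three, Matrix.det_fin_three, Matrix.det_fin_three, Matrix.det_fin_three,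
    postB_rel_AblockQ]
  refine ⟨by decide +kernel, by decide +kernel, by decide +kernel, by decide +kernel⟩

/-- **The slow electromechanical pencil eigenvalue EXISTS in `[38.64, 38.65]`**: a real `ν` and a real
`x ≠ 0` with `M⁻¹L(δ*) x = ν x`. CERTIFIED (matrix statement). [folklore] -/
theorem postB_rel_exists_eig_slow (lam : ℚ) (a : ℝ) :
    ∃ ν ∈ Icc (3864 / 100 : ℝ) (3865 / 100), ∃ x : Fin 3 → ℝ, x ≠ 0 ∧
      (postB_rel.toModelRel lam a).Ablock postB_rel.angleOf *ᵥ x = ν • x := by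
  obtain ⟨h1, h2, -, -⟩ := postB_rel_charDet_signs
  have hprod : ((3864 / 100 : ℚ) • (1 : Matrix (Fin 3) (Fin 3) ℚ) - postB_rel.AblockQ).det *
      ((3865 / 100 : ℚ) • (1 : Matrix (Fin 3) (Fin 3) ℚ) - postB_rel.AblockQ).det ≤ 0 := by nlinarith
  obtain ⟨ν, hν, x, hx, hAx⟩ := exists_eig_of_det_nonpos
    ((postB_rel.toModelRel lam a).Ablock postB_rel.angleOf) (a := ((3864 / 100 : ℚ) : ℝ))
    (b := ((3865 / 100 : ℚ) : ℝ)) (by norm_num) (by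
      rw [postB_rel_charDet, postB_rel_charDet]
      exact_mod_cast hprod)
  refine ⟨ν, ⟨?_, ?_⟩, x, hx, hAx⟩
  · have h := hν.1
    push_cast at h
    linarith
  · have h := hν.2
    push_cast at h
    linarith

/-- **The fast electromechanical pencil eigenvalue EXISTS in `[170.36, 170.37]`.** CERTIFIED. [folklore] -/
theorem postB_rel_exists_eig_fast (lam : ℚ) (a : ℝ) :
    ∃ ν ∈ Icc (17036 / 100 : ℝ) (17037 / 100), ∃ x : Fin 3 → ℝ, x ≠ 0 ∧
      (postB_rel.toModelRel lam a).Ablock postB_rel.angleOf *ᵥ x = ν • x := by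
  obtain ⟨-, -, h3, h4⟩ := postB_rel_charDet_signs
  have hprod : ((17036 / 100 : ℚ) • (1 : Matrix (Fin 3) (Fin 3) ℚ) - postB_rel.AblockQ).det *
      ((17037 / 100 : ℚ) • (1 : Matrix (Fin 3) (Fin 3) ℚ) - postB_rel.AblockQ).det ≤ 0 := by nlinarith
  obtain ⟨ν, hν, x, hx, hAx⟩ := exists_eig_of_det_nonpos
    ((postB_rel.toModelRel lam a).Ablock postB_rel.angleOf) (a := ((17036 / 100 : ℚ) : ℝ))
    (b := ((17037 / 100 : ℚ) : ℝ)) (by norm_num) (by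
      rw [postB_rel_charDet, postB_rel_charDet]
      exact_mod_cast hprod)
  refine ⟨ν, ⟨?_, ?_⟩, x, hx, hAx⟩
  · have h := hν.1
    push_cast at h
    linarith
  · have h := hν.2
    push_cast at h
    linarith

/-- **The slow mode pair of `J(δ*)` EXISTS, two-sided**: for every damping ratio `λ` with `λ² < 4·38.64`
the Jacobian of `postB_rel.toModelRel λ a′` at the equilibrium has an eigenpair with `Re z = −λ/2` and
`(Im z)² ∈ [38.64 − λ²/4, 38.65 − λ²/4]` (damped frequency `ω_d = |Im z|`). CERTIFIED (matrix statement);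
MODELLED: MV-2 + MV-P + MV-h12 + MV-λ. No stability sentence. [folklore] -/
theorem postB_rel_exists_mode_slow (lam : ℚ) (a : ℝ) (hlam : (lam : ℝ) ^ 2 < 4 * (3864 / 100)) :
    ∃ z : ℂ, ∃ w : Fin 3 ⊕ Fin 3 → ℂ, w ≠ 0 ∧
      ((postB_rel.toModelRel lam a).jacMatrix postB_rel.angleOf).map ((↑) : ℝ → ℂ) *ᵥ w = z • w ∧
      z.re = -((lam : ℝ) / 2) ∧
      (3864 / 100 - (lam : ℝ) ^ 2 / 4 ≤ z.im ^ 2 ∧ z.im ^ 2 ≤ 3865 / 100 - (lam : ℝ) ^ 2 / 4) := by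
  obtain ⟨ν, hν, x, hx, hAx⟩ := postB_rel_exists_eig_slow lam a
  obtain ⟨z, w, hw, hJ, hre, him⟩ :=
    secondOrderJac_eig_of_eig (d := (lam : ℝ)) hx hAx (by linarith [hν.1])
  refine ⟨z, w, hw, ?_, hre, ?_, ?_⟩
  · rw [(postB_rel.toModelRel lam a).jacMatrix_eq_secondOrderJac (postB_rel.toModelRel_uniformDamping lam a)
      (fun i => (postB_rel_M_pos lam a i).ne') postB_rel.angleOf]
    exact hJ
  · rw [him]; linarith [hν.1]
  · rw [him]; linarith [hν.2]

/-- **The fast mode pair of `J(δ*)` EXISTS, two-sided** (`(Im z)² ∈ [170.36 − λ²/4, 170.37 − λ²/4]`,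
`Re z = −λ/2`, for `λ² < 4·38.64`). CERTIFIED (matrix statement); MODELLED as above. [folklore] -/
theorem postB_rel_exists_mode_fast (lam : ℚ) (a : ℝ) (hlam : (lam : ℝ) ^ 2 < 4 * (3864 / 100)) :
    ∃ z : ℂ, ∃ w : Fin 3 ⊕ Fin 3 → ℂ, w ≠ 0 ∧
      ((postB_rel.toModelRel lam a).jacMatrix postB_rel.angleOf).map ((↑) : ℝ → ℂ) *ᵥ w = z • w ∧
      z.re = -((lam : ℝ) / 2) ∧
      (17036 / 100 - (lam : ℝ) ^ 2 / 4 ≤ z.im ^ 2 ∧ z.im ^ 2 ≤ 17037 / 100 - (lam : ℝ) ^ 2 / 4) := by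
  obtain ⟨ν, hν, x, hx, hAx⟩ := postB_rel_exists_eig_fast lam a
  obtain ⟨z, w, hw, hJ, hre, him⟩ :=
    secondOrderJac_eig_of_eig (d := (lam : ℝ)) hx hAx (by linarith [hν.1])
  refine ⟨z, w, hw, ?_, hre, ?_, ?_⟩
  · rw [(postB_rel.toModelRel lam a).jacMatrix_eq_secondOrderJac (postB_rel.toModelRel_uniformDamping lam a)
      (fun i => (postB_rel_M_pos lam a i).ne') postB_rel.angleOf]
    exact hJ
  · rw [him]; linarith [hν.1]
  · rw [him]; linarith [hν.2]

/-- At the λ = 1/10 of record: the slow mode pair has `Re z = −1/20` and damped frequency squared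
`ω_d² ∈ [38.6375, 38.6475]` (`ω_d ≈ 6.216 rad/s = 0.9893 Hz`), the fast one `ω_d² ∈ [170.3575, 170.3675]`
(`≈ 13.052 rad/s = 2.0773 Hz`). CERTIFIED (matrix statement); MODELLED: MV-2 + MV-P + MV-h12 + MV-λ. -/
theorem postB_rel_modes_tenth (a : ℝ) :
    (∃ z : ℂ, ∃ w : Fin 3 ⊕ Fin 3 → ℂ, w ≠ 0 ∧
      ((postB_rel.toModelRel (1 / 10) a).jacMatrix postB_rel.angleOf).map ((↑) : ℝ → ℂ) *ᵥ w = z • w ∧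
      z.re = -(1 / 20) ∧ (386375 / 10000 ≤ z.im ^ 2 ∧ z.im ^ 2 ≤ 386475 / 10000)) ∧
    (∃ z : ℂ, ∃ w : Fin 3 ⊕ Fin 3 → ℂ, w ≠ 0 ∧
      ((postB_rel.toModelRel (1 / 10) a).jacMatrix postB_rel.angleOf).map ((↑) : ℝ → ℂ) *ᵥ w = z • w ∧
      z.re = -(1 / 20) ∧ (1703575 / 10000 ≤ z.im ^ 2 ∧ z.im ^ 2 ≤ 1703675 / 10000)) := by
  constructor
  · obtain ⟨z, w, hw, hJ, hre, h1, h2⟩ := postB_rel_exists_mode_slow (1 / 10) a (by push_cast; norm_num)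
    refine ⟨z, w, hw, hJ, by rw [hre]; push_cast; norm_num, ?_, ?_⟩
    · push_cast at h1; norm_num at h1; linarith
    · push_cast at h2; norm_num at h2; linarith
  · obtain ⟨z, w, hw, hJ, hre, h1, h2⟩ := postB_rel_exists_mode_fast (1 / 10) a (by push_cast; norm_num)
    refine ⟨z, w, hw, hJ, by rw [hre]; push_cast; norm_num, ?_, ?_⟩
    · push_cast at h1; norm_num at h1; linarith
    · push_cast at h2; norm_num at h2; linarith

end WSCC9

end Summit.Ventures.GridStability.Models

end
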